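import Summits.FinalStateConjecture.FinalStateConjecture.Theorems.PhotonSphereChannelsTameCensorshipOfRobustKernels
import Summits.FinalStateConjecture.FinalStateConjecture.Theorems.PhotonSphereChannelsTameCensorshipResidualAnd
import Summits.FinalStateConjecture.FinalStateConjecture.Theorems.PhotonSphereChannelsTameCensorshipResidualMono
import Summits.FinalStateConjecture.FinalStateConjecture.Theorems.PhotonSphereChannelsTameCensorshipResidualTransport
import Summits.FinalStateConjecture.FinalStateConjecture.Theorems.PhotonSphereChannelsTameCensorshipResidualOfRobust
import Summits.FinalStateConjecture.FinalStateConjecture.Theorems.PhotonSphereChannelsTameCensorshipPathOfResidual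

/-!
# Route PhotonSphereChannels · crux `TameCensorship` (stmt-FinalStateConjecture-17431, K3 tame form) · line `Sketch`, skeleton v9 ·
# THE COMPOSITION from the RESIDUAL kernels (strictly weaker hypotheses than `…OfRobustKernels`)

Helper file (`--supports stmt-FinalStateConjecture-17431`) of line `Sketch` (lead c4, 2026-08-17, skeleton v9). Read-back of what the
composition of `Theorems/PhotonSphereChannelsTameCensorshipOfRobustKernels.lean` (p154904) USES of "an OPEN DENSE set of good radial
directions": only non-emptiness (`stub_pathOfRobust`) and closure under finite intersections (`stub_robustAnd`). The weakest `∧`-closed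
largeness notion with both properties is RESIDUAL = comeagre (`residual (EuclideanSpace ℝ (Fin p))`, Mathlib `Topology/GDelta/Basic`,
a `CountableInterFilter`; residual sets of the Baire space `ℝᵖ` are dense, `dense_of_mem_residual`). This file re-proves the composition
with the two kernels in RESIDUAL form — at every admissible datum, every compactly supported smooth admissible probe enriches to one along
all of whose further enrichments a RESIDUAL set of radial directions is good for all small non-zero parameters:

* `isTameChristodoulouGeneric_of_residual` — the abstract engine in the residual legend (`stub_pathOfResidual` p156048,
  `stub_witnessOfGoodPath` p136319);
* `residual_extremalChartFree_of_fg` — residual clause (i) at every admissible datum from the residual FUTURE-GOING half at every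
  admissible datum (`stub_probeTransport` p154120, `stub_residualTransport` p155993, `stub_residualAnd` p155972, `stub_residualMono`
  p156019, `stub_exists_reverse_development` p148572, `stub_orientationDichotomy` p149346, `fgExtremalChartFree_of_toSpacetime_eq`);
* `tameCensorship_of_residualKernels` — **K3 ⇐ [FG-residual third law] ∧ [residual tame outer region] ∧ `MGHDExists` (stmt-9937) ∧
  `CensorshipRobust` (stmt-10131)**; item 10131 keeps its open-dense form and enters through `stub_residualOfRobust` (p155981:
  open dense ⇒ residual).

The residual kernels are implied by the robust ones and are strictly weaker: they survive meagre, non-closed sets of bad DIRECTIONS — e.g.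
countably many conical strata (cones / hyperplanes of extremal or non-tame directions) through the datum, whose complement is residual but
not open — one of the accumulation scenarios named in the why-might-fail of items stmt-10131/10132; like the robust ones they do not survive
bad PARAMETERS accumulating at `t = 0` along a non-meagre set of rays (the ray form `∀ 0 < |t| < δ` is what K3's curve witness needs). They are the registered OPEN stubs `stub_fgExtremalChartFreeResidual` /
`stub_tameOuterResidual` of skeleton v9 (hypotheses 1–2 below, verbatim up to the opened namespaces `Function`/`Filter`/`Set` and
`residual _`). Nothing is claimed about them here.
-/

set_option linter.dupNamespace false
-- instance search through the nested operator type `E4 →L[ℝ] E4 →L[ℝ] ℝ` of metric components (as in the chart files)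
set_option maxSynthPendingDepth 3

open Literature.Geometry.Lorentzian
open scoped Manifold ContDiff Topology
open Filter Set Function

noncomputable section

namespace Summit.FinalStateConjecture.FinalStateConjecture.Theorems.PhotonSphereChannels.TameCensorshipUnwind

open Summit.FinalStateConjecture.FinalStateConjecture.Theses.PhotonSphereChannels (TameCensorship)
open Summit.FinalStateConjecture.FinalStateConjecture.Theses.RobustClausewiseGenericity (MGHDExists CensorshipRobust)
/-- **Tame genericity from RESIDUAL escapability (abstract engine of line `Sketch`, residual legend).** On the connected `3`-manifold `X`, let
`Q`, `P` be properties of initial data such that `P` is invariant under re-indexing an admissible datum by a diffeomorphism of `X`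
and `Q ⇒ P` on admissible data. If `Q` is residually escapable at every admissible datum (a RESIDUAL set of good radial directions along every further enrichment of an enrichment of every probe), then `P` is tame-Christodoulou-generic with
codimension `1` on `admissibleVacuumData X`: at an exceptional admissible `d`, robust escapability yields a compactly supported
smooth admissible path through `d` with `Q`-good (hence `P`-good) small non-zero members (`stub_pathOfResidual`: a residual subset of the Baire space `ℝⁿ` is non-empty), which is sheared
into a tame, immersed, injective admissible curve with `P`-good non-zero members (`stub_witnessOfGoodPath`); it meets the
exceptional set only at `0`. [folklore] -/
theorem isTameChristodoulouGeneric_of_residual :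
    ∀ (X : Type) [TopologicalSpace X] [ChartedSpace E3 X] [IsManifold (𝓡 3) ∞ X] [T2Space X]
    [SecondCountableTopology X] [ConnectedSpace X] (Q P : InitialDataSet (𝓡 3) X → Prop), (∀ (D : InitialDataSet
    (𝓡 3) X) (Φ : X ≃ₜ X) (hΦ : ContMDiff (𝓡 3) (𝓡 3) (∞ + 1) Φ) (hΦ' : ∀ u, Injective (mfderiv (𝓡 3) (𝓡 3) Φ u)),
    ContMDiff (𝓡 3) (𝓡 3) (∞ + 1) Φ.symm → (∀ u, Injective (mfderiv (𝓡 3) (𝓡 3) Φ.symm u)) → D ∈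
    admissibleVacuumData X → P D → P (D.comap Φ hΦ hΦ')) → (∀ D ∈ admissibleVacuumData X, Q D → P D) → (∀ d ∈
    admissibleVacuumData X, ∀ (m : ℕ) (G : EuclideanSpace ℝ (Fin m) → InitialDataSet (𝓡 3) X),
    (InitialDataSet.IsSmoothDataFamily m G ∧ G 0 = d ∧ (∀ c, G c ∈ admissibleVacuumData X) ∧ ∃ K : Set X,
    IsCompact K ∧ ∀ c, ∀ x ∉ K, (G c).h.inner x = d.h.inner x ∧ (G c).k x = d.k x) → ∃ (n : ℕ) (G₁ :
    EuclideanSpace ℝ (Fin n) → InitialDataSet (𝓡 3) X) (L : EuclideanSpace ℝ (Fin m) →ₗ[ℝ] EuclideanSpace ℝ (Fin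
    n)), Function.Injective L ∧ (InitialDataSet.IsSmoothDataFamily n G₁ ∧ G₁ 0 = d ∧ (∀ c, G₁ c ∈
    admissibleVacuumData X) ∧ ∃ K : Set X, IsCompact K ∧ ∀ c, ∀ x ∉ K, (G₁ c).h.inner x = d.h.inner x ∧ (G₁ c).k x
    = d.k x) ∧ (∀ c, G₁ (L c) = G c) ∧ ∀ (p : ℕ) (G₂ : EuclideanSpace ℝ (Fin p) → InitialDataSet (𝓡 3) X) (L' :
    EuclideanSpace ℝ (Fin n) →ₗ[ℝ] EuclideanSpace ℝ (Fin p)), Function.Injective L' →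
    (InitialDataSet.IsSmoothDataFamily p G₂ ∧ G₂ 0 = d ∧ (∀ c, G₂ c ∈ admissibleVacuumData X) ∧ ∃ K : Set X,
    IsCompact K ∧ ∀ c, ∀ x ∉ K, (G₂ c).h.inner x = d.h.inner x ∧ (G₂ c).k x = d.k x) → (∀ c, G₂ (L' c) = G₁ c) → ∃
    U : Set (EuclideanSpace ℝ (Fin p)), U ∈ residual (EuclideanSpace ℝ (Fin p)) ∧ ∀ v ∈ U, ∃ δ : ℝ, 0 < δ ∧ ∀ t :
    ℝ, t ≠ 0 → |t| < δ → Q (G₂ (t • v))) → InitialDataSet.IsTameChristodoulouGeneric (admissibleVacuumData X) P 1 := by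
  intro X _ _ _ _ _ _ Q P hgauge hQP hrob d hd
  obtain ⟨G, hG, hG0, hadm, hK, ε, hε, hgood⟩ := stub_pathOfResidual X d Q hd.1 (hrob d hd.1)
  obtain ⟨e, F, hF, himm, hF0, hinj, hFadm, hPgood⟩ :=
    stub_witnessOfGoodPath X P hgauge d G hG hG0 hd.1 hadm hK
      ⟨ε, hε, fun c hc hcε => hQP _ (hadm c) (hgood c hc hcε)⟩
  exact ⟨e, F, hF, himm, hF0, hinj, hFadm, fun c hc hmem => hmem.2 (hPgood c hc)⟩

/-- **Residual clause (i) from its future-going half** (the argument of `robust_extremalChartFree_of_fg`, residual legend). Clause (i) of K3 for an MGHD — no late chart modelled on a boosted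
EXTREMAL Kerr exterior with truncated `C²` deviation `→ 0` — carries no orientation token, so its robust form at a datum silently
contains a PAST third law. If the FUTURE-GOING half (push-forward of the boosted Kerr–Schild time vector `Λ V_{M,a}` eventually
future-directed on every truncated slab) is residually escapable at EVERY admissible datum, then so is clause (i): with the data
involution `rev = (h, k) ↦ (h, −k)` (chosen from `stub_exists_timeReverse`; `rev ∘ rev = id` by extensionality), the future-going
half at `rev d` transports to "future-going half of every MGHD of `rev D`" at `d` (`stub_probeTransport`, `stub_residualTransport`),
conjoins with the half at `d` (`stub_residualAnd`), and upgrades pointwise (`stub_residualMono`): an extremal late chart of an MGHD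
`𝒟` of `D` is future-going for `𝒟` — excluded — or for `𝒟.reverse` (`stub_orientationDichotomy`, `0 ≤ M` from `Kerr.IsExtremal`),
which is an MGHD of `rev D` (`stub_exists_reverse_development`) where it is a late chart with the same deviations
(`Spacetime.reverse_isLateChart_iff`) — excluded. [folklore] -/
theorem residual_extremalChartFree_of_fg :
    (∀ (X : Type) [TopologicalSpace X] [ChartedSpace E3 X] [IsManifold (𝓡 3) ∞ X] [T2Space X]
    [SecondCountableTopology X] [ConnectedSpace X], ∀ d ∈ admissibleVacuumData X, ∀ (m : ℕ) (G : EuclideanSpace ℝ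
    (Fin m) → InitialDataSet (𝓡 3) X), (InitialDataSet.IsSmoothDataFamily m G ∧ G 0 = d ∧ (∀ c, G c ∈
    admissibleVacuumData X) ∧ ∃ K : Set X, IsCompact K ∧ ∀ c, ∀ x ∉ K, (G c).h.inner x = d.h.inner x ∧ (G c).k x =
    d.k x) → ∃ (n : ℕ) (G₁ : EuclideanSpace ℝ (Fin n) → InitialDataSet (𝓡 3) X) (L : EuclideanSpace ℝ (Fin m)
    →ₗ[ℝ] EuclideanSpace ℝ (Fin n)), Function.Injective L ∧ (InitialDataSet.IsSmoothDataFamily n G₁ ∧ G₁ 0 = d ∧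
    (∀ c, G₁ c ∈ admissibleVacuumData X) ∧ ∃ K : Set X, IsCompact K ∧ ∀ c, ∀ x ∉ K, (G₁ c).h.inner x = d.h.inner x
    ∧ (G₁ c).k x = d.k x) ∧ (∀ c, G₁ (L c) = G c) ∧ ∀ (p : ℕ) (G₂ : EuclideanSpace ℝ (Fin p) → InitialDataSet (𝓡
    3) X) (L' : EuclideanSpace ℝ (Fin n) →ₗ[ℝ] EuclideanSpace ℝ (Fin p)), Function.Injective L' →
    (InitialDataSet.IsSmoothDataFamily p G₂ ∧ G₂ 0 = d ∧ (∀ c, G₂ c ∈ admissibleVacuumData X) ∧ ∃ K : Set X,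
    IsCompact K ∧ ∀ c, ∀ x ∉ K, (G₂ c).h.inner x = d.h.inner x ∧ (G₂ c).k x = d.k x) → (∀ c, G₂ (L' c) = G₁ c) → ∃
    U : Set (EuclideanSpace ℝ (Fin p)), U ∈ residual (EuclideanSpace ℝ (Fin p)) ∧ ∀ v ∈ U, ∃ δ : ℝ, 0 < δ ∧ ∀ t :
    ℝ, t ≠ 0 → |t| < δ → ∀ 𝒟 : VacuumCauchyDevelopment (G₂ (t • v)), 𝒟.IsMaximal → ∀ (Λ : lorentzGroup) (c : E4)
    (M a : ℝ), Kerr.IsExtremal M a → ¬ ∃ (τ₀ : ℝ) (Ψ : (boostedKerrBackground Λ c M a).domain → 𝒟.carrier),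
    𝒟.toSpacetime.IsLateChart (boostedKerrBackground Λ c M a) Set.univ τ₀ Ψ ∧ (∀ ρ : ℝ, ∀ᶠ τ in Filter.atTop, ∀ x
    ∈ (boostedKerrBackground Λ c M a).truncTimeSlab ρ τ, 𝒟.timeOrientation.IsFutureDirected (mfderiv 𝓘(ℝ, E4) (𝓡
    4) Ψ x ((Λ : E4 ≃L[ℝ] E4) (Kerr.timeVector M a (poincareInv Λ c (x : E4)))))) ∧ ∀ R : ℝ, Filter.Tendsto (fun τ
    => 𝒟.toSpacetime.truncDeviationCk (boostedKerrBackground Λ c M a) Ψ 2 R τ) Filter.atTop (nhds 0)) → ∀ (X :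
    Type) [TopologicalSpace X] [ChartedSpace E3 X] [IsManifold (𝓡 3) ∞ X] [T2Space X] [SecondCountableTopology X]
    [ConnectedSpace X], ∀ d ∈ admissibleVacuumData X, ∀ (m : ℕ) (G : EuclideanSpace ℝ (Fin m) → InitialDataSet (𝓡
    3) X), (InitialDataSet.IsSmoothDataFamily m G ∧ G 0 = d ∧ (∀ c, G c ∈ admissibleVacuumData X) ∧ ∃ K : Set X,
    IsCompact K ∧ ∀ c, ∀ x ∉ K, (G c).h.inner x = d.h.inner x ∧ (G c).k x = d.k x) → ∃ (n : ℕ) (G₁ :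
    EuclideanSpace ℝ (Fin n) → InitialDataSet (𝓡 3) X) (L : EuclideanSpace ℝ (Fin m) →ₗ[ℝ] EuclideanSpace ℝ (Fin
    n)), Function.Injective L ∧ (InitialDataSet.IsSmoothDataFamily n G₁ ∧ G₁ 0 = d ∧ (∀ c, G₁ c ∈
    admissibleVacuumData X) ∧ ∃ K : Set X, IsCompact K ∧ ∀ c, ∀ x ∉ K, (G₁ c).h.inner x = d.h.inner x ∧ (G₁ c).k x
    = d.k x) ∧ (∀ c, G₁ (L c) = G c) ∧ ∀ (p : ℕ) (G₂ : EuclideanSpace ℝ (Fin p) → InitialDataSet (𝓡 3) X) (L' :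
    EuclideanSpace ℝ (Fin n) →ₗ[ℝ] EuclideanSpace ℝ (Fin p)), Function.Injective L' →
    (InitialDataSet.IsSmoothDataFamily p G₂ ∧ G₂ 0 = d ∧ (∀ c, G₂ c ∈ admissibleVacuumData X) ∧ ∃ K : Set X,
    IsCompact K ∧ ∀ c, ∀ x ∉ K, (G₂ c).h.inner x = d.h.inner x ∧ (G₂ c).k x = d.k x) → (∀ c, G₂ (L' c) = G₁ c) → ∃
    U : Set (EuclideanSpace ℝ (Fin p)), U ∈ residual (EuclideanSpace ℝ (Fin p)) ∧ ∀ v ∈ U, ∃ δ : ℝ, 0 < δ ∧ ∀ t :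
    ℝ, t ≠ 0 → |t| < δ → ∀ 𝒟 : VacuumCauchyDevelopment (G₂ (t • v)), 𝒟.IsMaximal → (∀ (Λ : lorentzGroup) (c : E4)
    (M a : ℝ), Kerr.IsExtremal M a → ¬ ∃ (τ₀ : ℝ) (Ψ : (boostedKerrBackground Λ c M a).domain → 𝒟.carrier),
    𝒟.toSpacetime.IsLateChart (boostedKerrBackground Λ c M a) Set.univ τ₀ Ψ ∧ ∀ R : ℝ, Filter.Tendsto (fun τ =>
    𝒟.toSpacetime.truncDeviationCk (boostedKerrBackground Λ c M a) Ψ 2 R τ) Filter.atTop (nhds 0)) := by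
  intro hFG X _ _ _ _ _ _ d hd
  -- the data involution `rev = (h, k) ↦ (h, −k)` and its involutivity
  choose rev hrev_h hrev_k using stub_exists_timeReverse X
  have hrr : ∀ D : InitialDataSet (𝓡 3) X, rev (rev D) = D := by
    intro D
    rcases hrD : rev (rev D) with ⟨h₁, k₁, hk₁⟩
    rcases hD : D with ⟨h₂, k₂, hk₂⟩
    have hh : h₁ = h₂ := by
      have := (hrev_h (rev D)).trans (hrev_h D)
      rw [hrD, hD] at this
      exact this
    have hk : k₁ = k₂ := by
      funext x
      ext v w
      have := hrev_k (rev D) x v w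
      rw [hrev_k D x v w, neg_neg, hrD, hD] at this
      exact this
    cases hh
    cases hk
    rfl
  have hprobe := stub_probeTransport X rev hrev_h hrev_k
  have hrevadm : rev d ∈ admissibleVacuumData X :=
    stub_timeReverse_admissible X d (rev d) (hrev_h d) (hrev_k d) hd
  -- the future-going half at `d`, and at `rev d` transported back to `d`
  have h₁ := hFG X d hd
  have h₂ := stub_residualTransport X rev hrr hprobe d
    (fun D => ∀ 𝒟 : VacuumCauchyDevelopment D, 𝒟.IsMaximal → ∀ (Λ : lorentzGroup) (c : E4) (M a : ℝ),
    Kerr.IsExtremal M a → ¬ ∃ (τ₀ : ℝ) (Ψ : (boostedKerrBackground Λ c M a).domain → 𝒟.carrier),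
    𝒟.toSpacetime.IsLateChart (boostedKerrBackground Λ c M a) Set.univ τ₀ Ψ ∧ (∀ ρ : ℝ, ∀ᶠ τ in Filter.atTop, ∀ x
    ∈ (boostedKerrBackground Λ c M a).truncTimeSlab ρ τ, 𝒟.timeOrientation.IsFutureDirected (mfderiv 𝓘(ℝ, E4) (𝓡
    4) Ψ x ((Λ : E4 ≃L[ℝ] E4) (Kerr.timeVector M a (poincareInv Λ c (x : E4)))))) ∧ ∀ R : ℝ, Filter.Tendsto (fun τ
    => 𝒟.toSpacetime.truncDeviationCk (boostedKerrBackground Λ c M a) Ψ 2 R τ) Filter.atTop (nhds 0)) (hFG X (rev d) hrevadm)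
  -- conjoin and upgrade pointwise by the orientation dichotomy
  refine stub_residualMono X d
    (fun D => (∀ 𝒟 : VacuumCauchyDevelopment D, 𝒟.IsMaximal → ∀ (Λ : lorentzGroup) (c : E4) (M a : ℝ),
    Kerr.IsExtremal M a → ¬ ∃ (τ₀ : ℝ) (Ψ : (boostedKerrBackground Λ c M a).domain → 𝒟.carrier),
    𝒟.toSpacetime.IsLateChart (boostedKerrBackground Λ c M a) Set.univ τ₀ Ψ ∧ (∀ ρ : ℝ, ∀ᶠ τ in Filter.atTop, ∀ x
    ∈ (boostedKerrBackground Λ c M a).truncTimeSlab ρ τ, 𝒟.timeOrientation.IsFutureDirected (mfderiv 𝓘(ℝ, E4) (𝓡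
    4) Ψ x ((Λ : E4 ≃L[ℝ] E4) (Kerr.timeVector M a (poincareInv Λ c (x : E4)))))) ∧ ∀ R : ℝ, Filter.Tendsto (fun τ
    => 𝒟.toSpacetime.truncDeviationCk (boostedKerrBackground Λ c M a) Ψ 2 R τ) Filter.atTop (nhds 0)) ∧ (∀ 𝒟 :
    VacuumCauchyDevelopment (rev D), 𝒟.IsMaximal → ∀ (Λ : lorentzGroup) (c : E4) (M a : ℝ), Kerr.IsExtremal M a →
    ¬ ∃ (τ₀ : ℝ) (Ψ : (boostedKerrBackground Λ c M a).domain → 𝒟.carrier), 𝒟.toSpacetime.IsLateChart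
    (boostedKerrBackground Λ c M a) Set.univ τ₀ Ψ ∧ (∀ ρ : ℝ, ∀ᶠ τ in Filter.atTop, ∀ x ∈ (boostedKerrBackground Λ
    c M a).truncTimeSlab ρ τ, 𝒟.timeOrientation.IsFutureDirected (mfderiv 𝓘(ℝ, E4) (𝓡 4) Ψ x ((Λ : E4 ≃L[ℝ] E4)
    (Kerr.timeVector M a (poincareInv Λ c (x : E4)))))) ∧ ∀ R : ℝ, Filter.Tendsto (fun τ =>
    𝒟.toSpacetime.truncDeviationCk (boostedKerrBackground Λ c M a) Ψ 2 R τ) Filter.atTop (nhds 0)))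
    (fun D => ∀ 𝒟 : VacuumCauchyDevelopment D, 𝒟.IsMaximal → ∀ (Λ : lorentzGroup) (c : E4) (M a : ℝ),
    Kerr.IsExtremal M a → ¬ ∃ (τ₀ : ℝ) (Ψ : (boostedKerrBackground Λ c M a).domain → 𝒟.carrier),
    𝒟.toSpacetime.IsLateChart (boostedKerrBackground Λ c M a) Set.univ τ₀ Ψ ∧ ∀ R : ℝ, Filter.Tendsto (fun τ =>
    𝒟.toSpacetime.truncDeviationCk (boostedKerrBackground Λ c M a) Ψ 2 R τ) Filter.atTop (nhds 0))
    (fun D _ h 𝒟 hmax => ?_)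
    (stub_residualAnd X d
      (fun D => ∀ 𝒟 : VacuumCauchyDevelopment D, 𝒟.IsMaximal → ∀ (Λ : lorentzGroup) (c : E4) (M a : ℝ),
      Kerr.IsExtremal M a → ¬ ∃ (τ₀ : ℝ) (Ψ : (boostedKerrBackground Λ c M a).domain → 𝒟.carrier),
      𝒟.toSpacetime.IsLateChart (boostedKerrBackground Λ c M a) Set.univ τ₀ Ψ ∧ (∀ ρ : ℝ, ∀ᶠ τ in Filter.atTop, ∀
      x ∈ (boostedKerrBackground Λ c M a).truncTimeSlab ρ τ, 𝒟.timeOrientation.IsFutureDirected (mfderiv 𝓘(ℝ, E4)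
      (𝓡 4) Ψ x ((Λ : E4 ≃L[ℝ] E4) (Kerr.timeVector M a (poincareInv Λ c (x : E4)))))) ∧ ∀ R : ℝ, Filter.Tendsto
      (fun τ => 𝒟.toSpacetime.truncDeviationCk (boostedKerrBackground Λ c M a) Ψ 2 R τ) Filter.atTop (nhds 0))
      (fun D => ∀ 𝒟 : VacuumCauchyDevelopment (rev D), 𝒟.IsMaximal → ∀ (Λ : lorentzGroup) (c : E4) (M a : ℝ),
      Kerr.IsExtremal M a → ¬ ∃ (τ₀ : ℝ) (Ψ : (boostedKerrBackground Λ c M a).domain → 𝒟.carrier),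
      𝒟.toSpacetime.IsLateChart (boostedKerrBackground Λ c M a) Set.univ τ₀ Ψ ∧ (∀ ρ : ℝ, ∀ᶠ τ in Filter.atTop, ∀
      x ∈ (boostedKerrBackground Λ c M a).truncTimeSlab ρ τ, 𝒟.timeOrientation.IsFutureDirected (mfderiv 𝓘(ℝ, E4)
      (𝓡 4) Ψ x ((Λ : E4 ≃L[ℝ] E4) (Kerr.timeVector M a (poincareInv Λ c (x : E4)))))) ∧ ∀ R : ℝ, Filter.Tendsto
      (fun τ => 𝒟.toSpacetime.truncDeviationCk (boostedKerrBackground Λ c M a) Ψ 2 R τ) Filter.atTop (nhds 0)) h₁ h₂)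
  rintro Λ c M a hMa ⟨τ₀, Ψ, hΨ, hdev⟩
  rcases stub_orientationDichotomy 𝒟.toSpacetime Λ c M a hMa.2.le Ψ hΨ.contMDiff hdev with htok | htok
  · exact h.1 𝒟 hmax Λ c M a hMa ⟨τ₀, Ψ, hΨ, htok, hdev⟩
  · obtain ⟨𝒟', hmax', hS⟩ := stub_exists_reverse_development X D (rev D) (hrev_h D) (hrev_k D) 𝒟 hmax
    have h' := fgExtremalChartFree_of_toSpacetime_eq X (rev D) 𝒟' 𝒟.toSpacetime.reverse hS (h.2 𝒟' hmax')
    exact h' Λ c M a hMa ⟨τ₀, Ψ, (𝒟.toSpacetime.reverse_isLateChart_iff _ _ τ₀ Ψ).2 hΨ, htok, hdev⟩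

/-- **`TameCensorship` (K3, tame form) from the RESIDUAL kernels — the composition of line `Sketch`, skeleton v9, in the
library.** Hypotheses: (1) the FUTURE-GOING ROBUST DYNAMICAL THIRD LAW in late-chart form — at every admissible datum the property
"every MGHD has no late chart modelled on a boosted extremal Kerr exterior, with push-forward of the Kerr–Schild time vector
eventually future-directed on truncated slabs and truncated `C²` deviation `→ 0`" is RESIDUALLY escapable (open problem; Kehle–Unger
arXiv:2402.10190, Angelopoulos–Kehle–Unger arXiv:2410.16234 for the model picture); (2) ROBUST A-PRIORI TAMENESS — at every
admissible datum the property "every MGHD has `C³`-bounded geometry of `outer = J⁺(ιΣ) ∩ ⋃ I⁻(future-complete normalised rays)` at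
one scale with `C⁰`-deviation `≤ ½`" is RESIDUALLY escapable (open problem); (3) `MGHDExists` (item stmt-FinalStateConjecture-9937);
(4) `CensorshipRobust` (item stmt-FinalStateConjecture-10131). Proof: per `X`, the residual engine `isTameChristodoulouGeneric_of_residual` with
`Q D` = "(a) ∧ ((i) ∧ (ii)) for every MGHD of `D`" and `P` = the K3 property: gauge invariance of `P` is `stub_qK3ComapIff`, `Q ⇒ P`
on admissible data by `MGHDExists`, and `Q` is residually escapable at every admissible datum by `stub_residualAnd` from (4) (through `stub_residualOfRobust`),
`residual_extremalChartFree_of_fg` (1) and (2). [folklore] -/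
theorem tameCensorship_of_residualKernels :
    (∀ (X : Type) [TopologicalSpace X] [ChartedSpace E3 X] [IsManifold (𝓡 3) ∞ X] [T2Space X]
    [SecondCountableTopology X] [ConnectedSpace X], ∀ d ∈ admissibleVacuumData X, ∀ (m : ℕ) (G : EuclideanSpace ℝ
    (Fin m) → InitialDataSet (𝓡 3) X), (InitialDataSet.IsSmoothDataFamily m G ∧ G 0 = d ∧ (∀ c, G c ∈
    admissibleVacuumData X) ∧ ∃ K : Set X, IsCompact K ∧ ∀ c, ∀ x ∉ K, (G c).h.inner x = d.h.inner x ∧ (G c).k x =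
    d.k x) → ∃ (n : ℕ) (G₁ : EuclideanSpace ℝ (Fin n) → InitialDataSet (𝓡 3) X) (L : EuclideanSpace ℝ (Fin m)
    →ₗ[ℝ] EuclideanSpace ℝ (Fin n)), Injective L ∧ (InitialDataSet.IsSmoothDataFamily n G₁ ∧ G₁ 0 = d ∧ (∀ c, G₁ c
    ∈ admissibleVacuumData X) ∧ ∃ K : Set X, IsCompact K ∧ ∀ c, ∀ x ∉ K, (G₁ c).h.inner x = d.h.inner x ∧ (G₁ c).k
    x = d.k x) ∧ (∀ c, G₁ (L c) = G c) ∧ ∀ (p : ℕ) (G₂ : EuclideanSpace ℝ (Fin p) → InitialDataSet (𝓡 3) X) (L' :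
    EuclideanSpace ℝ (Fin n) →ₗ[ℝ] EuclideanSpace ℝ (Fin p)), Injective L' → (InitialDataSet.IsSmoothDataFamily p
    G₂ ∧ G₂ 0 = d ∧ (∀ c, G₂ c ∈ admissibleVacuumData X) ∧ ∃ K : Set X, IsCompact K ∧ ∀ c, ∀ x ∉ K, (G₂ c).h.inner
    x = d.h.inner x ∧ (G₂ c).k x = d.k x) → (∀ c, G₂ (L' c) = G₁ c) → ∃ U : Set (EuclideanSpace ℝ (Fin p)), U ∈
    residual _ ∧ ∀ v ∈ U, ∃ δ : ℝ, 0 < δ ∧ ∀ t : ℝ, t ≠ 0 → |t| < δ → ∀ 𝒟 : VacuumCauchyDevelopment (G₂ (t • v)),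
    𝒟.IsMaximal → ∀ (Λ : lorentzGroup) (c : E4) (M a : ℝ), Kerr.IsExtremal M a → ¬ ∃ (τ₀ : ℝ) (Ψ :
    (boostedKerrBackground Λ c M a).domain → 𝒟.carrier), 𝒟.toSpacetime.IsLateChart (boostedKerrBackground Λ c M a)
    univ τ₀ Ψ ∧ (∀ ρ : ℝ, ∀ᶠ τ in atTop, ∀ x ∈ (boostedKerrBackground Λ c M a).truncTimeSlab ρ τ,
    𝒟.timeOrientation.IsFutureDirected (mfderiv 𝓘(ℝ, E4) (𝓡 4) Ψ x ((Λ : E4 ≃L[ℝ] E4) (Kerr.timeVector M a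
    (poincareInv Λ c (x : E4)))))) ∧ ∀ R : ℝ, Tendsto (fun τ => 𝒟.toSpacetime.truncDeviationCk
    (boostedKerrBackground Λ c M a) Ψ 2 R τ) atTop (nhds 0)) → (∀ (X : Type) [TopologicalSpace X] [ChartedSpace E3
    X] [IsManifold (𝓡 3) ∞ X] [T2Space X] [SecondCountableTopology X] [ConnectedSpace X], ∀ d ∈
    admissibleVacuumData X, ∀ (m : ℕ) (G : EuclideanSpace ℝ (Fin m) → InitialDataSet (𝓡 3) X),
    (InitialDataSet.IsSmoothDataFamily m G ∧ G 0 = d ∧ (∀ c, G c ∈ admissibleVacuumData X) ∧ ∃ K : Set X,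
    IsCompact K ∧ ∀ c, ∀ x ∉ K, (G c).h.inner x = d.h.inner x ∧ (G c).k x = d.k x) → ∃ (n : ℕ) (G₁ :
    EuclideanSpace ℝ (Fin n) → InitialDataSet (𝓡 3) X) (L : EuclideanSpace ℝ (Fin m) →ₗ[ℝ] EuclideanSpace ℝ (Fin
    n)), Injective L ∧ (InitialDataSet.IsSmoothDataFamily n G₁ ∧ G₁ 0 = d ∧ (∀ c, G₁ c ∈ admissibleVacuumData X) ∧
    ∃ K : Set X, IsCompact K ∧ ∀ c, ∀ x ∉ K, (G₁ c).h.inner x = d.h.inner x ∧ (G₁ c).k x = d.k x) ∧ (∀ c, G₁ (L c)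
    = G c) ∧ ∀ (p : ℕ) (G₂ : EuclideanSpace ℝ (Fin p) → InitialDataSet (𝓡 3) X) (L' : EuclideanSpace ℝ (Fin n)
    →ₗ[ℝ] EuclideanSpace ℝ (Fin p)), Injective L' → (InitialDataSet.IsSmoothDataFamily p G₂ ∧ G₂ 0 = d ∧ (∀ c, G₂
    c ∈ admissibleVacuumData X) ∧ ∃ K : Set X, IsCompact K ∧ ∀ c, ∀ x ∉ K, (G₂ c).h.inner x = d.h.inner x ∧ (G₂
    c).k x = d.k x) → (∀ c, G₂ (L' c) = G₁ c) → ∃ U : Set (EuclideanSpace ℝ (Fin p)), U ∈ residual _ ∧ ∀ v ∈ U, ∃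
    δ : ℝ, 0 < δ ∧ ∀ t : ℝ, t ≠ 0 → |t| < δ → ∀ 𝒟 : VacuumCauchyDevelopment (G₂ (t • v)), 𝒟.IsMaximal → ∀
    [𝒟.metric.HasLeviCivita],
    let outer : Set 𝒟.carrier := 𝒟.metric.causalFuture 𝒟.timeOrientation (range 𝒟.embed) ∩ {q | ∃ (p : X) (γ : ℝ →
        𝒟.carrier) (dom : Set ℝ), 𝒟.metric.IsNormalisedNullRayFrom 𝒟.timeOrientation 𝒟.embed 𝒟.normal p γ dom ∧ ¬
        BddAbove dom ∧ q ∈ 𝒟.metric.chronologicalPast 𝒟.timeOrientation (γ '' (dom ∩ Ici 0))};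
    ∃ r₀ : ℝ, 0 < r₀ ∧ ∃ Λ : NNReal, ∀ q ∈ outer,
    let U : TopologicalSpace.Opens E4 := ⟨Metric.ball (0 : E4) r₀, Metric.isOpen_ball⟩;
    ∃ Ψ : U → 𝒟.carrier, 𝒟.toSpacetime.IsLateChart (Minkowski.backgroundOn U) univ (-r₀) Ψ ∧ (∃ x : U, (x : E4) =
    0 ∧ Ψ x = q) ∧ supCkENorm (U : Set E4) 3 (𝒟.toSpacetime.deviationExtend (Minkowski.backgroundOn U) Ψ) ≤ (Λ :
    ENNReal) ∧ supCkENorm (U : Set E4) 0 (𝒟.toSpacetime.deviationExtend (Minkowski.backgroundOn U) Ψ) ≤ 1 / 2) →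
    MGHDExists → CensorshipRobust → TameCensorship := by
  intro hFG hTO hM hC X _ _ _ _ _ _
  -- robust (i) at every admissible datum of `X`, from the future-going kernel
  have hI := residual_extremalChartFree_of_fg (fun Y _ _ _ _ _ _ d hd => hFG Y d hd) X
  refine isTameChristodoulouGeneric_of_residual X
      (fun D => (∀ 𝒟 : VacuumCauchyDevelopment D, 𝒟.IsMaximal → HasCompleteNullInfinity 𝒟.toCauchyDevelopment) ∧
      ((∀ 𝒟 : VacuumCauchyDevelopment D, 𝒟.IsMaximal → (∀ (Λ : lorentzGroup) (c : E4) (M a : ℝ), Kerr.IsExtremal M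
      a → ¬ ∃ (τ₀ : ℝ) (Ψ : (boostedKerrBackground Λ c M a).domain → 𝒟.carrier), 𝒟.toSpacetime.IsLateChart
      (boostedKerrBackground Λ c M a) Set.univ τ₀ Ψ ∧ ∀ R : ℝ, Filter.Tendsto (fun τ =>
      𝒟.toSpacetime.truncDeviationCk (boostedKerrBackground Λ c M a) Ψ 2 R τ) Filter.atTop (nhds 0))) ∧ (∀ 𝒟 :
      VacuumCauchyDevelopment D, 𝒟.IsMaximal → ∀ [𝒟.metric.HasLeviCivita],
      let outer : Set 𝒟.carrier := 𝒟.metric.causalFuture 𝒟.timeOrientation (Set.range 𝒟.embed) ∩ {q | ∃ (p : X) (γ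
          : ℝ → 𝒟.carrier) (dom : Set ℝ), 𝒟.metric.IsNormalisedNullRayFrom 𝒟.timeOrientation 𝒟.embed 𝒟.normal p γ
          dom ∧ ¬ BddAbove dom ∧ q ∈ 𝒟.metric.chronologicalPast 𝒟.timeOrientation (γ '' (dom ∩ Set.Ici 0))};
      ∃ r₀ : ℝ, 0 < r₀ ∧ ∃ Λ : NNReal, ∀ q ∈ outer,
      let U : TopologicalSpace.Opens E4 := ⟨Metric.ball (0 : E4) r₀, Metric.isOpen_ball⟩;
      ∃ Ψ : U → 𝒟.carrier, 𝒟.toSpacetime.IsLateChart (Minkowski.backgroundOn U) Set.univ (-r₀) Ψ ∧ (∃ x : U, (x :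
      E4) = 0 ∧ Ψ x = q) ∧ supCkENorm (U : Set E4) 3 (𝒟.toSpacetime.deviationExtend (Minkowski.backgroundOn U) Ψ)
      ≤ (Λ : ENNReal) ∧ supCkENorm (U : Set E4) 0 (𝒟.toSpacetime.deviationExtend (Minkowski.backgroundOn U) Ψ) ≤ 1
      / 2)))
    _ (fun D Φ hΦ hΦ' hΨ hΨ' _ h => (stub_qK3ComapIff X D Φ hΦ hΦ' hΨ hΨ').2 h)
    (fun D hD h => ⟨hM X D hD, fun 𝒟 h𝒟 => ⟨h.1 𝒟 h𝒟, h.2.1 𝒟 h𝒟, h.2.2 𝒟 h𝒟⟩⟩) fun d hd => ?_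
  exact stub_residualAnd X d
    (fun D => ∀ 𝒟 : VacuumCauchyDevelopment D, 𝒟.IsMaximal → HasCompleteNullInfinity 𝒟.toCauchyDevelopment)
    (fun D => (∀ 𝒟 : VacuumCauchyDevelopment D, 𝒟.IsMaximal → (∀ (Λ : lorentzGroup) (c : E4) (M a : ℝ),
    Kerr.IsExtremal M a → ¬ ∃ (τ₀ : ℝ) (Ψ : (boostedKerrBackground Λ c M a).domain → 𝒟.carrier),
    𝒟.toSpacetime.IsLateChart (boostedKerrBackground Λ c M a) Set.univ τ₀ Ψ ∧ ∀ R : ℝ, Filter.Tendsto (fun τ =>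
    𝒟.toSpacetime.truncDeviationCk (boostedKerrBackground Λ c M a) Ψ 2 R τ) Filter.atTop (nhds 0))) ∧ (∀ 𝒟 :
    VacuumCauchyDevelopment D, 𝒟.IsMaximal → ∀ [𝒟.metric.HasLeviCivita],
    let outer : Set 𝒟.carrier := 𝒟.metric.causalFuture 𝒟.timeOrientation (Set.range 𝒟.embed) ∩ {q | ∃ (p : X) (γ :
        ℝ → 𝒟.carrier) (dom : Set ℝ), 𝒟.metric.IsNormalisedNullRayFrom 𝒟.timeOrientation 𝒟.embed 𝒟.normal p γ dom
        ∧ ¬ BddAbove dom ∧ q ∈ 𝒟.metric.chronologicalPast 𝒟.timeOrientation (γ '' (dom ∩ Set.Ici 0))};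
    ∃ r₀ : ℝ, 0 < r₀ ∧ ∃ Λ : NNReal, ∀ q ∈ outer,
    let U : TopologicalSpace.Opens E4 := ⟨Metric.ball (0 : E4) r₀, Metric.isOpen_ball⟩;
    ∃ Ψ : U → 𝒟.carrier, 𝒟.toSpacetime.IsLateChart (Minkowski.backgroundOn U) Set.univ (-r₀) Ψ ∧ (∃ x : U, (x :
    E4) = 0 ∧ Ψ x = q) ∧ supCkENorm (U : Set E4) 3 (𝒟.toSpacetime.deviationExtend (Minkowski.backgroundOn U) Ψ) ≤
    (Λ : ENNReal) ∧ supCkENorm (U : Set E4) 0 (𝒟.toSpacetime.deviationExtend (Minkowski.backgroundOn U) Ψ) ≤ 1 /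
    2))
    (stub_residualOfRobust X d
      (fun D => ∀ 𝒟 : VacuumCauchyDevelopment D, 𝒟.IsMaximal → HasCompleteNullInfinity 𝒟.toCauchyDevelopment) (hC X d hd))
    (stub_residualAnd X d
      (fun D => ∀ 𝒟 : VacuumCauchyDevelopment D, 𝒟.IsMaximal → (∀ (Λ : lorentzGroup) (c : E4) (M a : ℝ),
      Kerr.IsExtremal M a → ¬ ∃ (τ₀ : ℝ) (Ψ : (boostedKerrBackground Λ c M a).domain → 𝒟.carrier),
      𝒟.toSpacetime.IsLateChart (boostedKerrBackground Λ c M a) Set.univ τ₀ Ψ ∧ ∀ R : ℝ, Filter.Tendsto (fun τ =>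
      𝒟.toSpacetime.truncDeviationCk (boostedKerrBackground Λ c M a) Ψ 2 R τ) Filter.atTop (nhds 0)))
      (fun D => ∀ 𝒟 : VacuumCauchyDevelopment D, 𝒟.IsMaximal → ∀ [𝒟.metric.HasLeviCivita],
      let outer : Set 𝒟.carrier := 𝒟.metric.causalFuture 𝒟.timeOrientation (Set.range 𝒟.embed) ∩ {q | ∃ (p : X) (γ
          : ℝ → 𝒟.carrier) (dom : Set ℝ), 𝒟.metric.IsNormalisedNullRayFrom 𝒟.timeOrientation 𝒟.embed 𝒟.normal p γ
          dom ∧ ¬ BddAbove dom ∧ q ∈ 𝒟.metric.chronologicalPast 𝒟.timeOrientation (γ '' (dom ∩ Set.Ici 0))};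
      ∃ r₀ : ℝ, 0 < r₀ ∧ ∃ Λ : NNReal, ∀ q ∈ outer,
      let U : TopologicalSpace.Opens E4 := ⟨Metric.ball (0 : E4) r₀, Metric.isOpen_ball⟩;
      ∃ Ψ : U → 𝒟.carrier, 𝒟.toSpacetime.IsLateChart (Minkowski.backgroundOn U) Set.univ (-r₀) Ψ ∧ (∃ x : U, (x :
      E4) = 0 ∧ Ψ x = q) ∧ supCkENorm (U : Set E4) 3 (𝒟.toSpacetime.deviationExtend (Minkowski.backgroundOn U) Ψ)
      ≤ (Λ : ENNReal) ∧ supCkENorm (U : Set E4) 0 (𝒟.toSpacetime.deviationExtend (Minkowski.backgroundOn U) Ψ) ≤ 1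
      / 2)
      (hI d hd) (hTO X d hd))

end Summit.FinalStateConjecture.FinalStateConjecture.Theorems.PhotonSphereChannels.TameCensorshipUnwind

end
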